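import Summits.QuantumFields.BalabanUV.T4Continuum.Support.B13AvgCorrKappaOneLetters
import Summits.QuantumFields.BalabanUV.T4Continuum.Support.B13AvgCorrKappa
import Summits.QuantumFields.BalabanUV.T4Continuum.Support.B13AvgCorrRefineVariation

/-!
# B13AvgCorrKappaOneBelow — row NE5, J-avg-reg SECOND ORDER (T4-DAG §8 Q52 (2), σ road), σ-END PART 2a: the ARITHMETIC of the step, the explicit
# constant `κ₁`, and the ACCUMULATED-CORRECTION QUOTIENT of the translate pair from the one-step letters BELOW the current level

Cell `pub-balaban`, unit `b2b-balaban-t4-ne5-formalise-leaf-09` (NE5 formalisation swarm LEAF PROVER 09, gen 20; σ-END CLAIM `HOME/CLAIMS.log` l.25204).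
Summits-side NEW WORK under the LEAN PLACEMENT RULE; [folklore] throughout; ONE `def` (the real constant `kappaOne`, a closed-form polynomial∕rational
expression in the displayed letters — no `Prop`, nothing asserted); no citation tag.

HONEST FRAMING: rung (B)+1 of the FINITE-VOLUME T⁴ programme — NOT infinite volume, NOT a mass gap, NOT the Clay problem, NOT a proof of NE5 (NOT PRINTED;
GAPS G-t4-U3-1).  [folklore] estimates on OUR objects (`expMeanLogSU`, `avgTower`, `corr`, `corrAcc`, `holAt`, `loopWord`, `GaugeField.translate`); nothing of
[Balaban1985Averaging] Props 5–10 ∕ [Balaban1985BackgroundPropagators] (3.35)–(3.36) ∕ [Balaban1987RG1] (0.4)–(0.7) is asserted, reproduced or certified —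
the window letters (α, β, β₂) are DISPLAYED hypotheses, discharged by nobody here.  HONEST DEPENDENCY (cell line, verbatim): continuum YM on T⁴ ⇐ BetaPertH ∧
nine spine estimates (0/9 proved); BetaPertH ⇐ (D1) ∧ (D4) ∧ CAP+tail; G-an2-4 gates asym, D1 and NE2/3/4.

WHAT.
* §0 ARITHMETIC (pure reals): `t1_eq`, `t2_le`, `t3_le`, `guard_le`, **`step_le`** — with `κ₁ := 9∕2·R + 6κ²∕δ_N`,
  `R = 4κβ(d+2) + 2κβ(d+2)(d+3) + c(B₂ + 2βB + 2(d+4)βB)`, `κ = 3cB`, `c = d∕2 + d²∕8`, `B = 2β + 2α²`, `B₂ = 2β₂ + 4αβ`, and `6(d+2) ≤ L`, the three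
  summands of the level-`i` loop quotient and the guard-jump term add up to `≤ κ₁∕ℓ³` (feedback coefficient `9∕4·(d+2)∕(L−1) ≤ 1∕2`).
* §0′ `kappaOne d α β β₂ δN` (the constant) and `kappaOne_nonneg`.
* §2 **`dist1_corrAcc_pair_le`** — for the translate pair `(V ∘ τ_{L^(i+1) e_ν}, V)`: from the window letters, κ-END's accumulated budgets
  (`B13AvgCorrKappa.dist1_corrAcc_avgTower_le`) and the ONE-STEP UNIT-SHIFT LETTERS BELOW `i`, the accumulated corrections satisfy
  `dist1 (corrAcc′ j b·(corrAcc j b)⁻¹) ≤ (κ₁ + 4κβ)·L³·L^i∕((L^K)³(L²−L))·(L^j)²` for all `j ≤ i` (σ-L3 `dist1_corrAcc_succ_quot_le_of_forall` level by level +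
  `tC_step`; the lower letters are TELESCOPED over `L^(i−j)` unit block shifts of the SAME field: `dist1_corr_translate_nsmul_quot_le`,
  `scaleTo_shift_eq_scaleTo_nsmul`, `dist1_corr_avgTower_pair_le` — geometric in the level, memo (S4)'s direct count, no log loss).
0 sorry; axioms ⊆ {propext, Classical.choice, Quot.sound}.
-/

noncomputable section

open scoped BigOperators Matrix Matrix.Norms.L2Operator

namespace Summit.QuantumFields.BalabanUV.T4Continuum.B13AvgCorrKappaOneBelow

open Literature.MathematicalPhysics.QuantumFieldTheory.Balaban1983to89
open Literature.MathematicalPhysics.QuantumFieldTheory.Balaban1983to89.T4Continuum (walk holAt loopWord walkEnd)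
open Literature.MathematicalPhysics.QuantumFieldTheory.Balaban1983to89.BlockAveraging (Idx off off_bounds loopHol corr)
open Literature.MathematicalPhysics.QuantumFieldTheory.Balaban1983to89.ExpMeanLog (expMeanLogSU deltaSU deltaSU_pos)
open Summit.QuantumFields.BalabanUV.T4Continuum.SubstrateAvgTowerStructure (avgTower axialTower corrAcc)
open Summit.QuantumFields.BalabanUV.T4Continuum.B13AvgCorrKappaOneLetters
open Literature.MathematicalPhysics.QuantumFieldTheory.Balaban1983to89.B5G183RateUnitTower (lev)
open Summit.QuantumFields.BalabanUV.T4Continuum.BalabanAveragedTowerUnit (cast_lev' one_le_lev')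


/-! ## §0 Arithmetic of the step (pure reals): the three summands of the loop quotient, the guard-jump term, the self-consistent `κ₁` -/

section Arith


/-- [folklore] the first summand of the loop quotient (accumulated quotient × `(d+2)L`) in closed form: `(d+2)∕(L−1)·(K₁+4κβ)∕ℓ³`. -/
theorem t1_eq {L Li ℓ d K₁ κ β : ℝ} (hL : 1 < L) (hLi : 0 < Li) (hℓ : 0 < ℓ) :
    (d + 2) * L * ((K₁ + 4 * κ * β) * L ^ 3 * Li / ((Li * L * ℓ) ^ 3 * (L ^ 2 - L)) * Li ^ 2)
      = (d + 2) / (L - 1) * ((K₁ + 4 * κ * β) / ℓ ^ 3) := by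
  have hL0 : 0 < L := by linarith
  have h1 : L - 1 ≠ 0 := by intro h; linarith
  have h1' : -1 + L ≠ 0 := by intro h; linarith
  have h2 : L ^ 2 - L ≠ 0 := by
    have : 0 < L ^ 2 - L := by nlinarith
    intro h; linarith
  field_simp

/-- [folklore] the second summand (straight-tower quotient × accumulated budget × `(d+2)L((d+2)L+1)`) is `≤ 2κβ(d+2)(d+3)∕ℓ³`. -/
theorem t2_le {L Li ℓ d κ β : ℝ} (hL : 1 ≤ L) (hLi : 0 < Li) (hℓ : 1 ≤ ℓ) (hd : 0 ≤ d) (hκ : 0 ≤ κ) (hβ : 0 ≤ β) :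
    Li * (Li * L * (β / (Li * L * ℓ) ^ 2)) * (2 * κ / (L * ℓ) ^ 2) * ((d + 2) * L * ((d + 2) * L + 1))
      ≤ 2 * κ * β * (d + 2) * (d + 3) / ℓ ^ 3 := by
  have hL0 : 0 < L := by linarith
  have hℓ0 : 0 < ℓ := by linarith
  have e : Li * (Li * L * (β / (Li * L * ℓ) ^ 2)) * (2 * κ / (L * ℓ) ^ 2) * ((d + 2) * L * ((d + 2) * L + 1))
      = 2 * κ * β * (d + 2) * ((d + 2) * L + 1) / (L ^ 2 * ℓ ^ 4) := by
    field_simp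
  rw [e, div_le_div_iff₀ (by positivity) (by positivity)]
  have h1 : (d + 2) * L + 1 ≤ (d + 3) * L ^ 2 := by
    nlinarith [mul_nonneg hd (mul_nonneg hL0.le (sub_nonneg.2 hL)), mul_nonneg hL0.le (sub_nonneg.2 hL)]
  have h2 : ℓ ^ 3 ≤ ℓ ^ 4 := pow_le_pow_right₀ hℓ (by norm_num)
  have hA : 0 ≤ 2 * κ * β * (d + 2) := by positivity
  calc 2 * κ * β * (d + 2) * ((d + 2) * L + 1) * ℓ ^ 3
      ≤ 2 * κ * β * (d + 2) * ((d + 3) * L ^ 2) * ℓ ^ 4 := by gcongr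
    _ = 2 * κ * β * (d + 2) * (d + 3) * (L ^ 2 * ℓ ^ 4) := by ring

/-- [folklore] the third summand (finest Stokes-for-differences term, area `≤ c·(L^{i+1})²`) is `≤ c(B₂ + 2βB + 2(d+4)βB)∕ℓ³`. -/
theorem t3_le {L Li ℓ d c B B₂ β : ℝ} (hL : 1 ≤ L) (hLi : 1 ≤ Li) (hℓ : 1 ≤ ℓ) (hd : 0 ≤ d) (hc : 0 ≤ c) (hB : 0 ≤ B)
    (hβ : 0 ≤ β) :
    c * (Li * L) ^ 2 * (Li * L * (B₂ / (Li * L * ℓ) ^ 3 + 2 * β * B / (Li * L * ℓ) ^ 4)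
        + 2 * (B / (Li * L * ℓ) ^ 2) * (Li * L * (β / (Li * L * ℓ) ^ 2)) * ((d + 2) * (Li * L) + 2))
      ≤ c * (B₂ + 2 * β * B + 2 * (d + 4) * β * B) / ℓ ^ 3 := by
  have hL0 : 0 < L := by linarith
  have hLi0 : 0 < Li := by linarith
  have hℓ0 : 0 < ℓ := by linarith
  set m := Li * L with hm
  have hm1 : 1 ≤ m := by rw [hm]; nlinarith
  have hm0 : 0 < m := by linarith
  have e : c * m ^ 2 * (m * (B₂ / (m * ℓ) ^ 3 + 2 * β * B / (m * ℓ) ^ 4)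
        + 2 * (B / (m * ℓ) ^ 2) * (m * (β / (m * ℓ) ^ 2)) * ((d + 2) * m + 2))
      = c * (B₂ / ℓ ^ 3 + 2 * β * B / (m * ℓ ^ 4) + 2 * β * B * ((d + 2) * m + 2) / (m * ℓ ^ 4)) := by
    field_simp
  have h1 : 2 * β * B / (m * ℓ ^ 4) ≤ 2 * β * B / ℓ ^ 3 := by
    apply div_le_div_of_nonneg_left (by positivity) (by positivity)
    calc ℓ ^ 3 = 1 * (ℓ ^ 3 * 1) := by ring
      _ ≤ m * (ℓ ^ 3 * ℓ) := by gcongr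
      _ = m * ℓ ^ 4 := by ring
  have h2 : 2 * β * B * ((d + 2) * m + 2) / (m * ℓ ^ 4) ≤ 2 * (d + 4) * β * B / ℓ ^ 3 := by
    rw [div_le_div_iff₀ (by positivity) (by positivity)]
    have h3 : (d + 2) * m + 2 ≤ (d + 4) * m := by nlinarith
    have h4 : ℓ ^ 3 ≤ ℓ ^ 4 := pow_le_pow_right₀ hℓ (by norm_num)
    have hA : 0 ≤ 2 * β * B := by positivity
    calc 2 * β * B * ((d + 2) * m + 2) * ℓ ^ 3 ≤ 2 * β * B * ((d + 4) * m) * ℓ ^ 4 := by gcongr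
      _ = 2 * (d + 4) * β * B * (m * ℓ ^ 4) := by ring
  have h0 : B₂ / ℓ ^ 3 + 2 * β * B / ℓ ^ 3 + 2 * (d + 4) * β * B / ℓ ^ 3 = (B₂ + 2 * β * B + 2 * (d + 4) * β * B) / ℓ ^ 3 := by
    field_simp
  have key : B₂ / ℓ ^ 3 + 2 * β * B / (m * ℓ ^ 4) + 2 * β * B * ((d + 2) * m + 2) / (m * ℓ ^ 4)
      ≤ (B₂ + 2 * β * B + 2 * (d + 4) * β * B) / ℓ ^ 3 := by linarith
  rw [e]
  calc c * (B₂ / ℓ ^ 3 + 2 * β * B / (m * ℓ ^ 4) + 2 * β * B * ((d + 2) * m + 2) / (m * ℓ ^ 4))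
      ≤ c * ((B₂ + 2 * β * B + 2 * (d + 4) * β * B) / ℓ ^ 3) := mul_le_mul_of_nonneg_left key hc
    _ = c * (B₂ + 2 * β * B + 2 * (d + 4) * β * B) / ℓ ^ 3 := (mul_div_assoc _ _ _).symm

/-- [folklore] the guard-jump term of σ-L4's threshold-free socket: `3(κ∕ℓ²)²∕δ_N ≤ 3κ²∕δ_N∕ℓ³` for `ℓ ≥ 1`. -/
theorem guard_le {ℓ κ δN : ℝ} (hℓ : 1 ≤ ℓ) (hδ : 0 < δN) :
    3 * (κ / ℓ ^ 2) ^ 2 / δN ≤ 3 * κ ^ 2 / δN / ℓ ^ 3 := by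
  have hℓ0 : 0 < ℓ := by linarith
  have e : 3 * (κ / ℓ ^ 2) ^ 2 / δN = 3 * κ ^ 2 / δN / ℓ ^ 4 := by
    field_simp
  rw [e]
  exact div_le_div_of_nonneg_left (by positivity) (by positivity) (pow_le_pow_right₀ hℓ (by norm_num))

/-- [folklore] **THE STEP ARITHMETIC**: with `K₁ := 9∕2·R + 6κ²∕δ_N`, `R := 4κβ(d+2) + 2κβ(d+2)(d+3) + c(B₂ + 2βB + 2(d+4)βB)` and `6(d+2) ≤ L`
(so the feedback coefficient `9∕4·(d+2)∕(L−1) ≤ 1∕2`), `9∕4·(T1 + T2 + T3) + G ≤ K₁∕ℓ³`. -/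
theorem step_le {L Li ℓ d c B B₂ β κ δN K₁ : ℝ} (hL6 : 6 * (d + 2) ≤ L) (hd : 1 ≤ d) (hLi : 1 ≤ Li) (hℓ : 1 ≤ ℓ)
    (hc : 0 ≤ c) (hB : 0 ≤ B) (hB₂ : 0 ≤ B₂) (hβ : 0 ≤ β) (hκ : 0 ≤ κ) (hδ : 0 < δN)
    (hK₁ : K₁ = 9 / 2 * (4 * κ * β * (d + 2) + 2 * κ * β * (d + 2) * (d + 3) + c * (B₂ + 2 * β * B + 2 * (d + 4) * β * B)) + 6 * κ ^ 2 / δN) :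
    9 / 4 * ((d + 2) * L * ((K₁ + 4 * κ * β) * L ^ 3 * Li / ((Li * L * ℓ) ^ 3 * (L ^ 2 - L)) * Li ^ 2)
        + Li * (Li * L * (β / (Li * L * ℓ) ^ 2)) * (2 * κ / (L * ℓ) ^ 2) * ((d + 2) * L * ((d + 2) * L + 1))
        + (c * (Li * L) ^ 2 * (Li * L * (B₂ / (Li * L * ℓ) ^ 3 + 2 * β * B / (Li * L * ℓ) ^ 4)
            + 2 * (B / (Li * L * ℓ) ^ 2) * (Li * L * (β / (Li * L * ℓ) ^ 2)) * ((d + 2) * (Li * L) + 2))))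
      + 3 * (κ / ℓ ^ 2) ^ 2 / δN ≤ K₁ / ℓ ^ 3 := by
  have hL1 : 1 < L := by linarith
  have hL1' : 1 ≤ L := hL1.le
  have hLi0 : 0 < Li := by linarith
  have hℓ0 : 0 < ℓ := by linarith
  have hℓ3 : 0 < ℓ ^ 3 := by positivity
  have hK₁0 : 0 ≤ K₁ := by rw [hK₁]; positivity
  rw [t1_eq hL1 hLi0 hℓ0]
  have h2 := t2_le (d := d) (κ := κ) hL1' hLi0 hℓ (by linarith) hκ hβ
  have h3 := t3_le (d := d) (c := c) (B := B) (B₂ := B₂) hL1' hLi hℓ (by linarith) hc hB hβ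
  have hg := guard_le (κ := κ) hℓ hδ
  -- the feedback: (d+2)/(L−1) ≤ 2/9
  have hfb : (d + 2) / (L - 1) ≤ 2 / 9 := by
    rw [div_le_div_iff₀ (by linarith) (by norm_num)]; nlinarith
  have hT1 : (d + 2) / (L - 1) * ((K₁ + 4 * κ * β) / ℓ ^ 3) ≤ 2 / 9 * ((K₁ + 4 * κ * β) / ℓ ^ 3) :=
    mul_le_mul_of_nonneg_right hfb (by positivity)
  -- the numerator inequality
  have hnum : 9 / 4 * (2 / 9 * (K₁ + 4 * κ * β) + 2 * κ * β * (d + 2) * (d + 3) + c * (B₂ + 2 * β * B + 2 * (d + 4) * β * B))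
      + 3 * κ ^ 2 / δN ≤ K₁ := by
    have hkb : 0 ≤ κ * β := mul_nonneg hκ hβ
    have hkbd : 0 ≤ κ * β * d := mul_nonneg hkb (by linarith)
    have key : K₁ - (9 / 4 * (2 / 9 * (K₁ + 4 * κ * β) + 2 * κ * β * (d + 2) * (d + 3) + c * (B₂ + 2 * β * B + 2 * (d + 4) * β * B))
        + 3 * κ ^ 2 / δN) = 9 * (κ * β * d) + 16 * (κ * β) := by rw [hK₁]; ring
    linarith [key]
  -- assemble over the common denominator ℓ³
  have e : 9 / 4 * (2 / 9 * ((K₁ + 4 * κ * β) / ℓ ^ 3) + 2 * κ * β * (d + 2) * (d + 3) / ℓ ^ 3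
        + c * (B₂ + 2 * β * B + 2 * (d + 4) * β * B) / ℓ ^ 3) + 3 * κ ^ 2 / δN / ℓ ^ 3
      = (9 / 4 * (2 / 9 * (K₁ + 4 * κ * β) + 2 * κ * β * (d + 2) * (d + 3) + c * (B₂ + 2 * β * B + 2 * (d + 4) * β * B))
          + 3 * κ ^ 2 / δN) / ℓ ^ 3 := by
    field_simp
  calc 9 / 4 * ((d + 2) / (L - 1) * ((K₁ + 4 * κ * β) / ℓ ^ 3)
          + Li * (Li * L * (β / (Li * L * ℓ) ^ 2)) * (2 * κ / (L * ℓ) ^ 2) * ((d + 2) * L * ((d + 2) * L + 1))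
          + (c * (Li * L) ^ 2 * (Li * L * (B₂ / (Li * L * ℓ) ^ 3 + 2 * β * B / (Li * L * ℓ) ^ 4)
              + 2 * (B / (Li * L * ℓ) ^ 2) * (Li * L * (β / (Li * L * ℓ) ^ 2)) * ((d + 2) * (Li * L) + 2))))
        + 3 * (κ / ℓ ^ 2) ^ 2 / δN
      ≤ 9 / 4 * (2 / 9 * ((K₁ + 4 * κ * β) / ℓ ^ 3) + 2 * κ * β * (d + 2) * (d + 3) / ℓ ^ 3
          + c * (B₂ + 2 * β * B + 2 * (d + 4) * β * B) / ℓ ^ 3) + 3 * κ ^ 2 / δN / ℓ ^ 3 := by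
        gcongr
    _ = _ := e
    _ ≤ K₁ / ℓ ^ 3 := div_le_div_of_nonneg_right hnum hℓ3.le


end Arith


/-! ## §0′ The constant `κ₁` (explicit in `d, α, β, β₂` and the guard radius `δ_N`; INDEPENDENT of `i`, `K`, `V`, `L` and the volume) -/

/-- [folklore] **THE CORRECTION-VARIATION CONSTANT** `κ₁(d, α, β, β₂, δ_N) := 9∕2·R + 6κ²∕δ_N`, with `κ = 3c(2β+2α²)`, `c = d∕2 + d²∕8`,
`R = 4κβ(d+2) + 2κβ(d+2)(d+3) + c·((2β₂+4αβ) + 2β(2β+2α²) + 2(d+4)β(2β+2α²))` — the self-consistent choice of §0's `step_le`. -/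
def kappaOne (d α β β₂ δN : ℝ) : ℝ :=
  9 / 2 * (4 * (3 * ((d / 2 + d ^ 2 / 8) * (2 * β + 2 * α ^ 2))) * β * (d + 2)
      + 2 * (3 * ((d / 2 + d ^ 2 / 8) * (2 * β + 2 * α ^ 2))) * β * (d + 2) * (d + 3)
      + (d / 2 + d ^ 2 / 8) * ((2 * β₂ + 4 * α * β) + 2 * β * (2 * β + 2 * α ^ 2) + 2 * (d + 4) * β * (2 * β + 2 * α ^ 2)))
    + 6 * (3 * ((d / 2 + d ^ 2 / 8) * (2 * β + 2 * α ^ 2))) ^ 2 / δN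

/-- [folklore] `κ₁ ≥ 0` for nonnegative data. -/
theorem kappaOne_nonneg {d α β β₂ δN : ℝ} (hd : 0 ≤ d) (hα : 0 ≤ α) (hβ : 0 ≤ β) (hβ₂ : 0 ≤ β₂) (hδ : 0 < δN) :
    0 ≤ kappaOne d α β β₂ δN := by
  unfold kappaOne; positivity

/-! ## §2 The accumulated-correction quotient `tC` at level `i` from the one-step letters BELOW `i` -/

section Acc

variable {P : Params} {G : Type*} [GaugeGroup G] (ℰ : LoopAverage G)

/-- [folklore] unit block shifts compose: `(c + q e_ν) + e_ν = c + (q+1) e_ν`. -/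
theorem translate_succ_nsmul {j : ℕ} (c : PBond P j) (q : ℕ) (ν : Fin P.d) :
    (c.translate (q • (0 : Site P j).shift ν)).translate ((0 : Site P j).shift ν) = c.translate ((q + 1) • (0 : Site P j).shift ν) := by
  rw [PBond.translate_translate, ← succ_nsmul]

/-- [folklore] **TELESCOPING THE ONE-STEP LETTER over `q` unit block shifts**: if every unit shift of a level-`(j+1)` block moves the correction factor
by at most `k` (in `dist1`-quotient), then `q` unit shifts move it by at most `q·k`. -/
theorem dist1_corr_translate_nsmul_quot_le {j : ℕ} (U : GaugeField P j G) (ν : Fin P.d) {k : ℝ}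
    (hk : ∀ c : PBond P (j + 1), dist1 (corr ℰ U (c.translate ((0 : Site P (j + 1)).shift ν)) * (corr ℰ U c)⁻¹) ≤ k) :
    ∀ (q : ℕ) (c : PBond P (j + 1)), dist1 (corr ℰ U (c.translate (q • (0 : Site P (j + 1)).shift ν)) * (corr ℰ U c)⁻¹) ≤ q * k
  | 0, c => by
    have e : c.translate ((0 : ℕ) • (0 : Site P (j + 1)).shift ν) = c := by cases c; simp [PBond.translate]
    rw [e, mul_inv_cancel, GaugeGroup.dist1_one, Nat.cast_zero, zero_mul]
  | q + 1, c => by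
    have ih := dist1_corr_translate_nsmul_quot_le U ν hk q c
    have hstep := hk (c.translate (q • (0 : Site P (j + 1)).shift ν))
    rw [translate_succ_nsmul] at hstep
    calc dist1 (corr ℰ U (c.translate ((q + 1) • (0 : Site P (j + 1)).shift ν)) * (corr ℰ U c)⁻¹)
        ≤ dist1 (corr ℰ U (c.translate ((q + 1) • (0 : Site P (j + 1)).shift ν)) * (corr ℰ U (c.translate (q • (0 : Site P (j + 1)).shift ν)))⁻¹)
          + dist1 (corr ℰ U (c.translate (q • (0 : Site P (j + 1)).shift ν)) * (corr ℰ U c)⁻¹) := B15.PrelimIntegrations.dist1_fluct_le _ _ _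
      _ ≤ k + q * k := add_le_add hstep ih
      _ = ((q + 1 : ℕ) : ℝ) * k := by push_cast; ring

/-- [folklore] the finest translation of the level-`(i+1)` unit block shift IS the finest translation of `L^(i−j)` level-`(j+1)` unit block shifts (`j ≤ i`):
`scaleTo (i+1) e_ν = scaleTo (j+1) (L^(i−j) • e_ν) = L^(i+1) • e_ν`. -/
theorem scaleTo_shift_eq_scaleTo_nsmul {i j : ℕ} (hji : j ≤ i) (ν : Fin P.d) :
    Site.scaleTo (i + 1) ((0 : Site P (i + 1)).shift ν) = Site.scaleTo (j + 1) (P.L ^ (i - j) • (0 : Site P (j + 1)).shift ν) := by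
  rw [map_nsmul, scaleTo_zero_shift, scaleTo_zero_shift, smul_smul, ← pow_add]
  congr 2; omega

/-- [folklore] **THE ONE-STEP LETTER OF THE PAIR `(V ∘ τ, V)` AT A LOWER LEVEL `j ≤ i`** (τ the finest translation of the level-`(i+1)` unit block shift):
from the unit-shift letter `k` of level `j`, `dist1 (corr ℰ U_j(V ∘ τ) c′·(corr ℰ U_j(V) c′)⁻¹) ≤ L^(i−j)·k` — the translate is `L^(i−j)` unit block shifts
of level `j+1` (PART 1 `corr_avgTower_translate`), telescoped. -/
theorem dist1_corr_avgTower_pair_le {i j : ℕ} (hji : j ≤ i) (V : GaugeField P 0 G) (ν : Fin P.d) {k : ℝ}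
    (hk : ∀ c : PBond P (j + 1), dist1 (corr ℰ (avgTower ℰ V j) (c.translate ((0 : Site P (j + 1)).shift ν)) * (corr ℰ (avgTower ℰ V j) c)⁻¹) ≤ k)
    (c' : PBond P (j + 1)) :
    dist1 (corr ℰ (avgTower ℰ (V.translate (Site.scaleTo (i + 1) ((0 : Site P (i + 1)).shift ν))) j) c' * (corr ℰ (avgTower ℰ V j) c')⁻¹)
      ≤ ((P.L ^ (i - j) : ℕ) : ℝ) * k := by
  rw [scaleTo_shift_eq_scaleTo_nsmul hji, corr_avgTower_translate]
  exact dist1_corr_translate_nsmul_quot_le ℰ _ ν hk (P.L ^ (i - j)) c'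

end Acc

section AccSU

variable {P : Params} {n : Type*} [Fintype n] [DecidableEq n] [Nonempty n] {o : Type*} [Fintype o] [DecidableEq o]
  (ι : Matrix.specialUnitaryGroup n ℂ →* Matrix o o ℂ)

/-- [folklore] **THE ARITHMETIC OF ONE ACCUMULATION STEP** (pure reals): with `A·L·Lj = LK` (`A = L^(K−1−j)`), `B·Lj = LK` (`B = L^(K−j)`),
`C·Lj = Li` (`C = L^(i−j)`), `Lj ≤ LK`, and the majorant `E j = p·Lj²`, `p = (K₁ + 4κβ)·L³·Li∕(LK³·(L² − L))`:
`C·K₁∕A³ + L·(p·Lj²) + 2·(2κ∕B²)·(Lj·(L·Li·β∕LK²))·L² ≤ p·(Lj·L)²`. -/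
theorem tC_step {L A B C Lj Li LK K₁ κ β : ℝ} (hL : 1 < L) (hLj : 0 < Lj) (hLK : 0 < LK)
    (hκ : 0 ≤ κ) (hβ : 0 ≤ β) (hLi : 0 ≤ Li)
    (eA : A * L * Lj = LK) (eB : B * Lj = LK) (eC : C * Lj = Li) (hjK : Lj ≤ LK) :
    C * (K₁ / A ^ 3) + L * ((K₁ + 4 * κ * β) * L ^ 3 * Li / (LK ^ 3 * (L ^ 2 - L)) * Lj ^ 2)
        + 2 * (2 * κ / B ^ 2) * (Lj * (L * Li * (β / LK ^ 2))) * L ^ 2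
      ≤ (K₁ + 4 * κ * β) * L ^ 3 * Li / (LK ^ 3 * (L ^ 2 - L)) * (Lj * L) ^ 2 := by
  have hL0 : 0 < L := by linarith
  have hLL : 0 < L ^ 2 - L := by nlinarith
  -- rewrite `A`, `B`, `C` away: `A = LK∕(L·Lj)`, `B = LK∕Lj`, `C = Li∕Lj`
  have eA' : A = LK / (L * Lj) := by rw [eq_div_iff (by positivity)]; linarith [eA]
  have eB' : B = LK / Lj := by rw [eq_div_iff (by positivity)]; linarith [eB]
  have eC' : C = Li / Lj := by rw [eq_div_iff (by positivity)]; linarith [eC]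
  rw [eA', eB', eC']
  -- the first summand is `K₁ L³ Li Lj²∕LK³`, the cross term is `4κβ L³ Li Lj³∕LK⁴ ≤ 4κβ L³ Li Lj²∕LK³`
  have h1 : Li / Lj * (K₁ / (LK / (L * Lj)) ^ 3) = K₁ * L ^ 3 * Li * Lj ^ 2 / LK ^ 3 := by
    field_simp
  have h2 : 2 * (2 * κ / (LK / Lj) ^ 2) * (Lj * (L * Li * (β / LK ^ 2))) * L ^ 2 = 4 * κ * β * L ^ 3 * Li * Lj ^ 3 / LK ^ 4 := by
    field_simp; ring
  have h2' : 4 * κ * β * L ^ 3 * Li * Lj ^ 3 / LK ^ 4 ≤ 4 * κ * β * L ^ 3 * Li * Lj ^ 2 / LK ^ 3 := by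
    rw [div_le_div_iff₀ (by positivity) (by positivity)]
    have : Lj ^ 3 * LK ^ 3 ≤ Lj ^ 2 * LK ^ 4 := by nlinarith [pow_pos hLj 2, pow_pos hLK 3, mul_le_mul_of_nonneg_left hjK (le_of_lt (mul_pos (pow_pos hLj 2) (pow_pos hLK 3)))]
    nlinarith [mul_nonneg (mul_nonneg (mul_nonneg (mul_nonneg (by norm_num : (0:ℝ) ≤ 4) hκ) hβ) (pow_nonneg hL0.le 3)) hLi]
  rw [h1, h2]
  have hLLne : L ^ 2 - L ≠ 0 := ne_of_gt hLL
  have hLKne : LK ^ 3 ≠ 0 := by positivity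
  have hL1ne : L - 1 ≠ 0 := by intro h; linarith
  have hL1ne' : -1 + L ≠ 0 := by intro h; linarith
  have h3 : K₁ * L ^ 3 * Li * Lj ^ 2 / LK ^ 3 + L * ((K₁ + 4 * κ * β) * L ^ 3 * Li / (LK ^ 3 * (L ^ 2 - L)) * Lj ^ 2)
      + 4 * κ * β * L ^ 3 * Li * Lj ^ 2 / LK ^ 3 = (K₁ + 4 * κ * β) * L ^ 3 * Li / (LK ^ 3 * (L ^ 2 - L)) * (Lj * L) ^ 2 := by
    field_simp
    ring
  linarith [h3, h2']

/-- [folklore] **THE ACCUMULATED-CORRECTION QUOTIENT `tC` OF THE PAIR `(V ∘ τ, V)`** (τ = the finest translation of the level-`(i+1)` unit block shift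
`e_ν`): from the window letters (for `t₀` and κ-END's budgets `a_j`) and the ONE-STEP UNIT-SHIFT LETTERS BELOW `i` — `∀ j < i, ∀ c′,
dist1 (corr ℰ U_j (c′ + e_ν)·(corr ℰ U_j c′)⁻¹) ≤ K₁∕(L^(K−1−j))³` (the strong-induction hypothesis) — the level-`j` accumulated corrections of the two
fields satisfy `dist1 (corrAcc′ j b·(corrAcc j b)⁻¹) ≤ (K₁ + 4κβ)·L³·L^i∕((L^K)³·(L²−L))·(L^j)²` for every `j ≤ i` (σ-L3's one-step recursion
`dist1_corrAcc_succ_quot_le_of_forall` + `tC_step`; geometric in the level — memo (S4)'s DIRECT count, no log loss). -/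
theorem dist1_corrAcc_pair_le (hι : ∀ g, ι g ∈ Matrix.unitaryGroup o ℂ) (hdist : ∀ g, ‖ι g - 1‖ = dist1 g)
    (hL6 : 6 * (P.d + 2) ≤ P.L) (V : GaugeField P 0 (Matrix.specialUnitaryGroup n ℂ)) {α β : ℝ} (hβ : 0 ≤ β)
    (hsize : ∀ b : PBond P 0, (P.L : ℝ) ^ P.K * dist1 (V b) ≤ α)
    (hlip : ∀ (x : Site P 0) (ν μ : Fin P.d), (P.L : ℝ) ^ P.K * ‖ι (V ⟨x.shift μ, ν⟩) - ι (V ⟨x, ν⟩)‖ ≤ β / (P.L : ℝ) ^ P.K)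
    {i : ℕ} (hi : i < P.K) (ν : Fin P.d) {K₁ : ℝ} (hK₁ : 0 ≤ K₁)
    (hbelow : ∀ j < i, ∀ c' : PBond P (j + 1),
      dist1 (corr (expMeanLogSU (n := n)) (avgTower (expMeanLogSU (n := n)) V j) (c'.translate ((0 : Site P (j + 1)).shift ν))
        * (corr (expMeanLogSU (n := n)) (avgTower (expMeanLogSU (n := n)) V j) c')⁻¹) ≤ K₁ / ((P.L : ℝ) ^ (P.K - 1 - j)) ^ 3) :
    ∀ j ≤ i, ∀ b : PBond P j,
      dist1 (corrAcc (expMeanLogSU (n := n)) (V.translate (Site.scaleTo (i + 1) ((0 : Site P (i + 1)).shift ν))) j b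
          * (corrAcc (expMeanLogSU (n := n)) V j b)⁻¹)
        ≤ (K₁ + 4 * (3 * (((P.d : ℝ) / 2 + (P.d : ℝ) ^ 2 / 8) * (2 * β + 2 * α ^ 2))) * β) * (P.L : ℝ) ^ 3 * (P.L : ℝ) ^ i
            / (((P.L : ℝ) ^ P.K) ^ 3 * ((P.L : ℝ) ^ 2 - P.L)) * ((P.L : ℝ) ^ j) ^ 2 := by
  set κ : ℝ := 3 * (((P.d : ℝ) / 2 + (P.d : ℝ) ^ 2 / 8) * (2 * β + 2 * α ^ 2)) with hκdef
  set V' := V.translate (Site.scaleTo (i + 1) ((0 : Site P (i + 1)).shift ν)) with hV'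
  have hL1 : (1 : ℝ) < P.L := by have : 2 ≤ P.L := by omega
                                 exact_mod_cast this
  have hL0 : (0 : ℝ) < P.L := by linarith
  have hκ0 : 0 ≤ κ := by positivity
  have hcomm := dist1_commutator_le ι hι hdist
  -- the finest bond quotient `t₀`
  have hT : Site.scaleTo (i + 1) ((0 : Site P (i + 1)).shift ν) = P.L ^ (i + 1) • (0 : Site P 0).shift ν := scaleTo_zero_shift (i + 1) ν
  have ht : ∀ b : PBond P 0, dist1 (V' b * (V b)⁻¹) ≤ ((P.L ^ (i + 1) : ℕ) : ℝ) * (β / ((P.L : ℝ) ^ P.K) ^ 2) := fun b => by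
    rw [hV', hT]; exact dist1_translate_nsmul_quot_le ι hι hdist V hlip ν (P.L ^ (i + 1)) b
  have ht' : ∀ b : PBond P 0, dist1 (V' b * (V b)⁻¹) ≤ P.L * (P.L : ℝ) ^ i * (β / ((P.L : ℝ) ^ P.K) ^ 2) := fun b => by
    have h := ht b; rw [Nat.cast_pow, pow_succ] at h; linarith
  intro j
  induction j with
  | zero =>
    intro _ b
    rw [SubstrateAvgTowerStructure.corrAcc_zero, SubstrateAvgTowerStructure.corrAcc_zero, inv_one, mul_one, GaugeGroup.dist1_one]
    have hLL : (0 : ℝ) < (P.L : ℝ) ^ 2 - P.L := by nlinarith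
    positivity
  | succ j IH =>
    intro hj b
    have hji : j ≤ i := by omega
    have hjlt : j < i := by omega
    -- κ-END's budget at level j and the IH
    have ha := fun b => B13AvgCorrKappa.dist1_corrAcc_avgTower_le ι hι hdist hL6 V hβ hsize hlip (j := j) (by omega) b
    have hE := IH hji
    -- σ-L3's one-step recursion
    have hrec := B13AvgCorrRefineVariation.dist1_corrAcc_succ_quot_le_of_forall (expMeanLogSU (n := n)) hcomm V V' j
      (by positivity) (by positivity) ha hE ht' b
    -- the one-step letter at level `j < i`, telescoped over `L^(i−j)` unit block shifts
    have hone := dist1_corr_avgTower_pair_le (expMeanLogSU (n := n)) hji V ν (hbelow j hjlt) b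
    refine hrec.trans ((add_le_add (add_le_add hone le_rfl) le_rfl).trans ?_)
    -- arithmetic
    have hsub1 : P.K - 1 - j + 1 + j = P.K := by omega
    have hsub2 : P.K - j + j = P.K := by omega
    have hsub3 : i - j + j = i := by omega
    have eA : (P.L : ℝ) ^ (P.K - 1 - j) * P.L * (P.L : ℝ) ^ j = (P.L : ℝ) ^ P.K := by
      rw [← pow_succ, ← pow_add, hsub1]
    have eB : (P.L : ℝ) ^ (P.K - j) * (P.L : ℝ) ^ j = (P.L : ℝ) ^ P.K := by rw [← pow_add, hsub2]
    have eC : (((P.L ^ (i - j) : ℕ) : ℝ)) * (P.L : ℝ) ^ j = (P.L : ℝ) ^ i := by rw [Nat.cast_pow, ← pow_add, hsub3]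
    have hjK : (P.L : ℝ) ^ j ≤ (P.L : ℝ) ^ P.K := pow_le_pow_right₀ hL1.le (by omega)
    have key := tC_step (K₁ := K₁) (κ := κ) (β := β) hL1 (pow_pos hL0 j) (pow_pos hL0 _) hκ0 hβ (pow_nonneg hL0.le i) eA eB eC hjK
    rw [pow_succ]
    exact key

end AccSU


end Summit.QuantumFields.BalabanUV.T4Continuum.B13AvgCorrKappaOneBelow

end
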